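import Summits.NavierStokesRegularity.NavierStokesRegularity.Theorems.RootDecompReynoldsHorizonFloor
import HarnessLib

/-!
# Route `RootDecompReynoldsHorizon` (N13): `Assembly` (item stmt-NavierStokesRegularity-28925) — closing link

The proof is `Theorems.RootDecompReynoldsHorizonFloor.rootDecompReynoldsHorizon_assembly_proof` (lens-5 g22
«THE REYNOLDS FLOOR», landed with workitem stmt-NavierStokesRegularity-28921); this file is the by-name closing
link for the route's `Assembly` item (= its `closes`: V → E → P1 → NavierStokesRegularity). Implication-shaped:
closing it closes neither V stmt-NavierStokesRegularity-28919 nor E stmt-NavierStokesRegularity-28920 nor the summit.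
-/

set_option linter.dupNamespace false

namespace Summit.NavierStokesRegularity.NavierStokesRegularity.Theorems.RootDecompReynoldsHorizonAssembly

/-- **`Assembly` of route `RootDecompReynoldsHorizon`, item stmt-NavierStokesRegularity-28925**: PROVED
(`RootDecompReynoldsHorizonFloor.rootDecompReynoldsHorizon_assembly_proof`). [cite: KochNadirashviliSereginSverak2009, §6] -/
theorem assembly_holds :
    Summit.NavierStokesRegularity.NavierStokesRegularity.Theses.RootDecompReynoldsHorizon.Assembly :=
  RootDecompReynoldsHorizonFloor.rootDecompReynoldsHorizon_assembly_proof

end Summit.NavierStokesRegularity.NavierStokesRegularity.Theorems.RootDecompReynoldsHorizonAssembly
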